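import Mathlib
import HarnessLib
import Summits.Ventures.LatticeQCDFlow.Scaling.AutoregressiveGaugePlaquetteReads

/-!
# LatticeQCDFlow / Scaling — THE LOG-LIKELIHOOD FORM: a link-blind proposal density has expected
# log-likelihood at most that of its Haar average, hence (normalised) at most that of the flat proposal

HONEST FRAMING: exact (Metropolis-corrected) sampling algorithms for lattice gauge theory;
figures of merit are autocorrelation/cost numbers at stated couplings and volumes; no
continuum-physics claim.

Venture `LatticeQCDFlow` (cell pub-lqcd), topic `Scaling`, FANOUT row 30 (lean-1, GEN-18) — OUR WORK for
THEORY-2 §4 row C5 (gauge case), the information-theoretic companion of `Scaling/AutoregressiveGaugeBlindProposal`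
/ `…ProposalAveraging` (there: Wilson-weighted `L¹`; here: the maximum-likelihood training objective).  Any `d`,
`L`, compact group `G` (Haar probability `μ`, `π = μ^{⊗E}`), NON-NEGATIVE bounded measurable gauge-invariant
weight `F`, integrated links `s`, `N = A_s F`; a measurable "proposal density" `q` with `0 < c ≤ q ≤ C`.

* §1 **`cornerThrough_moves`**, **`cornerOut_moves`** — the corner moves packaged: a family
  of `π`-preserving measurable equivalences `T_g` acting on the two retained links at a site `y` whose other
  links are integrated, leaving every such `A_{s'} F` invariant (tree `coordAvg_pathHolonomy`,
  `coordAvg_eq_of_gaugeRelated_off`).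
* §2 **`integral_mul_log_le_of_moves`** — abstract: moves fixing `N` and acting on `q` through the
  `ℓ₁`-coordinate by Haar-preserving maps give `∫ N·log q dπ ≤ ∫ N·log q̄ dπ`, `q̄(U) = ∫ q(U[ℓ₁ ↦ v]) dv`
  (Fubini + Jensen for the concave `log`).
* §3 **`integral_mul_log_le_avg_of_cornerThrough / Out`** — at such a corner, for `q` blind to `ℓ₂`:
  `∫ N·log q dπ ≤ ∫ N·log q̄ dπ`; **`integral_mul_log_nonpos_of_corner*`** — if moreover `q` is a probability
  density in the `ℓ₁` coordinate then `∫ N·log q dπ ≤ 0 = ∫ N·log 1 dπ`; **`integral_weight_mul_log_nonpos_of_cornerThrough`**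
  — the same against the weight itself, `∫ F·log q dπ ≤ 0`, when `q` reads no integrated link (tower property,
  tree `integral_mul_coordAvg_eq`).

READING (value-free): `(1/Z)∫ F·log q dπ` is the expected log-likelihood (minus the maximum-likelihood training loss)
of the conditional `q` for `ℓ₁` in an exact autoregressive factorisation whose later links are `s`; a conditional
ignoring the partner link `ℓ₂` of a corner whose other links come later NEVER beats the flat Haar conditional, for
every compact gauge group and dimension.  NOT CLAIMED: conditionals reading `ℓ₂`; any number of ours.  No `def`.
-/

noncomputable section

namespace Summit.Ventures.LatticeQCDFlow.Theory2.Autoregressive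

open MeasureTheory Function Set
open Literature.MathematicalPhysics.QuantumFieldTheory
open Summit.Ventures.LatticeQCDFlow.Exactness

variable {d L : ℕ} {G : Type*} [Group G] [TopologicalSpace G] [IsTopologicalGroup G] [CompactSpace G]
  [SecondCountableTopology G] [MeasurableSpace G] [BorelSpace G] [NeZero L]

/-! ## §1 The corner moves, packaged -/

omit [SecondCountableTopology G] in
/-- **THROUGH-corner moves** (`ℓ₁` arrives at `y`, `ℓ₂` leaves): `T_g U = U[ℓ₁ ↦ U_{ℓ₁}g⁻¹][ℓ₂ ↦ gU_{ℓ₂}]`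
preserves `π` and every `A_{s'} F` with `s'` containing the other links at `y` (`F` gauge invariant). [ours] -/
theorem cornerThrough_moves {F : GaugeConfig d L G → ℝ} (hF : IsGaugeInvariant F)
    {y : Site d L} {ℓ₁ ℓ₂ : Edge d L} (hne : ℓ₁ ≠ ℓ₂) (h₁ : ℓ₁.1.shift ℓ₁.2 = y) (h₁' : ℓ₁.1 ≠ y)
    (h₂ : ℓ₂.1 = y) (h₂' : ℓ₂.1.shift ℓ₂.2 ≠ y) :
    ∃ T : G → (GaugeConfig d L G ≃ᵐ GaugeConfig d L G),
      (∀ g, MeasurePreserving (T g) (Measure.pi fun _ : Edge d L => haarProbability G)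
        (Measure.pi fun _ : Edge d L => haarProbability G)) ∧
      (∀ g U, T g U = update (update U ℓ₁ (U ℓ₁ * g⁻¹)) ℓ₂ (g * U ℓ₂)) ∧
      ∀ s' : Finset (Edge d L), (∀ e : Edge d L, e.1 = y ∨ e.1.shift e.2 = y → e ≠ ℓ₁ → e ≠ ℓ₂ → e ∈ s') →
        ∀ g U, coordAvg (haarProbability G) s' F (T g U) = coordAvg (haarProbability G) s' F U := by
  classical
  set μ := haarProbability G with hμ
  let T : G → (GaugeConfig d L G ≃ᵐ GaugeConfig d L G) := fun g =>
    MeasurableEquiv.piCongrRight fun e =>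
      if e = ℓ₁ then MeasurableEquiv.mulRight g⁻¹
      else if e = ℓ₂ then MeasurableEquiv.mulLeft g else MeasurableEquiv.refl G
  have hT : ∀ (g : G) (U : GaugeConfig d L G),
      T g U = update (update U ℓ₁ (U ℓ₁ * g⁻¹)) ℓ₂ (g * U ℓ₂) := by
    intro g U
    funext e
    by_cases he2 : e = ℓ₂
    · subst he2; simp [T, MeasurableEquiv.piCongrRight, hne.symm]
    · by_cases he1 : e = ℓ₁
      · subst he1; simp [T, MeasurableEquiv.piCongrRight, update_of_ne hne]
      · simp [T, MeasurableEquiv.piCongrRight, he1, he2]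
  refine ⟨T, fun g => ?_, hT, fun s' hst g U => ?_⟩
  · refine measurePreserving_pi (fun _ : Edge d L => μ) (fun _ : Edge d L => μ) fun e => ?_
    by_cases he1 : e = ℓ₁
    · subst he1; simpa [T] using measurePreserving_mul_right μ g⁻¹
    · by_cases he2 : e = ℓ₂
      · subst he2; simpa [T, he1] using measurePreserving_mul_left μ g
      · simpa [T, he1, he2] using MeasurePreserving.id μ
  · rw [hT]; exact coordAvg_pathHolonomy hF hne h₁ h₁' h₂ h₂' hst U g

omit [SecondCountableTopology G] in
/-- **OUT-corner moves** (both links leave `y`): `T_g U = U[ℓ₁ ↦ gU_{ℓ₁}][ℓ₂ ↦ gU_{ℓ₂}]` preserves `π` and every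
`A_{s'} F` with `s'` containing the other links at `y`. [ours] -/
theorem cornerOut_moves {F : GaugeConfig d L G → ℝ} (hF : IsGaugeInvariant F)
    {y : Site d L} {ℓ₁ ℓ₂ : Edge d L} (hne : ℓ₁ ≠ ℓ₂) (h₁ : ℓ₁.1 = y) (h₁' : ℓ₁.1.shift ℓ₁.2 ≠ y)
    (h₂ : ℓ₂.1 = y) (h₂' : ℓ₂.1.shift ℓ₂.2 ≠ y) :
    ∃ T : G → (GaugeConfig d L G ≃ᵐ GaugeConfig d L G),
      (∀ g, MeasurePreserving (T g) (Measure.pi fun _ : Edge d L => haarProbability G)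
        (Measure.pi fun _ : Edge d L => haarProbability G)) ∧
      (∀ g U, T g U = update (update U ℓ₁ (g * U ℓ₁)) ℓ₂ (g * U ℓ₂)) ∧
      ∀ s' : Finset (Edge d L), (∀ e : Edge d L, e.1 = y ∨ e.1.shift e.2 = y → e ≠ ℓ₁ → e ≠ ℓ₂ → e ∈ s') →
        ∀ g U, coordAvg (haarProbability G) s' F (T g U) = coordAvg (haarProbability G) s' F U := by
  classical
  set μ := haarProbability G with hμ
  let T : G → (GaugeConfig d L G ≃ᵐ GaugeConfig d L G) := fun g =>
    MeasurableEquiv.piCongrRight fun e =>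
      if e = ℓ₁ then MeasurableEquiv.mulLeft g
      else if e = ℓ₂ then MeasurableEquiv.mulLeft g else MeasurableEquiv.refl G
  have hT : ∀ (g : G) (U : GaugeConfig d L G),
      T g U = update (update U ℓ₁ (g * U ℓ₁)) ℓ₂ (g * U ℓ₂) := by
    intro g U
    funext e
    by_cases he2 : e = ℓ₂
    · subst he2; simp [T, MeasurableEquiv.piCongrRight, hne.symm]
    · by_cases he1 : e = ℓ₁
      · subst he1; simp [T, MeasurableEquiv.piCongrRight, update_of_ne hne]
      · simp [T, MeasurableEquiv.piCongrRight, he1, he2]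
  refine ⟨T, fun g => ?_, hT, fun s' hst g U => ?_⟩
  · refine measurePreserving_pi (fun _ : Edge d L => μ) (fun _ : Edge d L => μ) fun e => ?_
    by_cases he1 : e = ℓ₁
    · subst he1; simpa [T] using measurePreserving_mul_left μ g
    · by_cases he2 : e = ℓ₂
      · subst he2; simpa [T, he1] using measurePreserving_mul_left μ g
      · simpa [T, he1, he2] using MeasurePreserving.id μ
  · rw [hT]
    refine coordAvg_eq_of_gaugeRelated_off s' hF (Pi.mulSingle y g) fun e he => ?_
    by_cases he₂ : e = ℓ₂
    · subst he₂
      rw [update_self, gaugeTransform_mulSingle_apply_of_fst_eq g U h₂ h₂']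
    rw [update_of_ne he₂]
    by_cases he₁ : e = ℓ₁
    · subst he₁
      rw [update_self, gaugeTransform_mulSingle_apply_of_fst_eq g U h₁ h₁']
    rw [update_of_ne he₁]
    have hni : ¬ (e.1 = y ∨ e.1.shift e.2 = y) := fun hi => he (hst e hi he₁ he₂)
    exact (gaugeTransform_mulSingle_apply_of_not_incident y g U (fun h1 => hni (Or.inl h1))
      (fun h2 => hni (Or.inr h2))).symm

/-! ## §2 The abstract log-likelihood averaging lemma -/

omit [SecondCountableTopology G] in
/-- **LOG-LIKELIHOOD AVERAGING** (abstract form).  `π`-preserving moves `T_g` fixing the non-negative bounded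
measurable `Nf` and acting on the measurable `q`, `0 < c ≤ q ≤ C`, through the `ℓ₁`-coordinate by jointly
measurable maps `c_g` pushing Haar to Haar: `∫ Nf·log q dπ ≤ ∫ Nf·log q̄ dπ`, `q̄(U) = ∫ q(U[ℓ₁ ↦ v]) dv`
(Fubini; Jensen for the concave logarithm). [ours] -/
theorem integral_mul_log_le_of_moves (ℓ₁ : Edge d L)
    {Nf : GaugeConfig d L G → ℝ} (hNm : Measurable Nf) (hN0 : ∀ U, 0 ≤ Nf U) (hNb : ∃ C, ∀ U, Nf U ≤ C)
    {q : GaugeConfig d L G → ℝ} (hqm : Measurable q) (hqc : ∃ c, 0 < c ∧ ∀ U, c ≤ q U)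
    (hqC : ∃ C, ∀ U, q U ≤ C)
    (T : G → (GaugeConfig d L G ≃ᵐ GaugeConfig d L G))
    (hTmp : ∀ g, MeasurePreserving (T g) (Measure.pi fun _ : Edge d L => haarProbability G)
      (Measure.pi fun _ : Edge d L => haarProbability G))
    (hNT : ∀ g U, Nf (T g U) = Nf U)
    (c : G → G → G) (hc : Measurable (uncurry c))
    (hcmp : ∀ v : G, MeasurePreserving (fun g => c g v) (haarProbability G) (haarProbability G))
    (hqT : ∀ g U, q (T g U) = q (update U ℓ₁ (c g (U ℓ₁)))) :
    ∫ U, Nf U * Real.log (q U) ∂Measure.pi (fun _ : Edge d L => haarProbability G) ≤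
      ∫ U, Nf U * Real.log (∫ v, q (update U ℓ₁ v) ∂(haarProbability G))
        ∂Measure.pi (fun _ : Edge d L => haarProbability G) := by
  classical
  set μ := haarProbability G with hμ
  set π := Measure.pi (fun _ : Edge d L => μ) with hπ
  obtain ⟨CN, hCN⟩ := hNb
  obtain ⟨c₀, hc₀, hcq⟩ := hqc
  obtain ⟨Cq, hCq⟩ := hqC
  have hqpos : ∀ U, 0 < q U := fun U => lt_of_lt_of_le hc₀ (hcq U)
  -- `|log t| ≤ B` on `[c₀, Cq]`
  set B := |Real.log c₀| + |Real.log Cq| with hB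
  have hlogb : ∀ t : ℝ, c₀ ≤ t → t ≤ Cq → |Real.log t| ≤ B := by
    intro t ht1 ht2
    have h0 : 0 < t := lt_of_lt_of_le hc₀ ht1
    have hlo : Real.log c₀ ≤ Real.log t := Real.log_le_log hc₀ ht1
    have hhi : Real.log t ≤ Real.log Cq := Real.log_le_log h0 ht2
    rw [abs_le]
    constructor
    · linarith [neg_abs_le (Real.log c₀), abs_nonneg (Real.log Cq)]
    · linarith [le_abs_self (Real.log Cq), abs_nonneg (Real.log c₀)]
  have hNabs : ∀ U, |Nf U| ≤ CN := fun U => by rw [abs_of_nonneg (hN0 U)]; exact hCN U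
  have hCN0 : 0 ≤ CN := (hN0 1).trans (hCN 1)
  -- the integrand after the move, as a function of `(g, U)`
  set φ : G → GaugeConfig d L G → ℝ := fun g U => Nf U * Real.log (q (update U ℓ₁ (c g (U ℓ₁)))) with hφ
  -- Step 1: for every `g` the integral is unchanged by the move
  have hstep1 : ∀ g : G, ∫ U, Nf U * Real.log (q U) ∂π = ∫ U, φ g U ∂π := by
    intro g
    have h := (hTmp g).integral_comp' (fun U => Nf U * Real.log (q U))
    rw [← h]
    refine integral_congr_ae (ae_of_all _ fun U => ?_)
    show Nf (T g U) * Real.log (q (T g U)) = Nf U * Real.log (q (update U ℓ₁ (c g (U ℓ₁))))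
    rw [hNT, hqT]
  -- joint measurability and boundedness
  have hupd : Measurable fun p : G × GaugeConfig d L G => update p.2 ℓ₁ (c p.1 (p.2 ℓ₁)) := by
    refine measurable_pi_lambda _ fun e => ?_
    by_cases he : e = ℓ₁
    · subst he
      simp only [update_self]
      exact hc.comp (measurable_fst.prodMk ((measurable_pi_apply _).comp measurable_snd))
    · simp only [update_of_ne he]
      exact (measurable_pi_apply e).comp measurable_snd
  have hqum : Measurable fun p : G × GaugeConfig d L G => q (update p.2 ℓ₁ (c p.1 (p.2 ℓ₁))) :=
    hqm.comp hupd
  have hφm : Measurable (uncurry φ) :=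
    (hNm.comp measurable_snd).mul (Real.measurable_log.comp hqum)
  have hφb : ∀ g U, |φ g U| ≤ CN * B := by
    intro g U
    simp only [hφ, abs_mul]
    exact mul_le_mul (hNabs U) (hlogb _ (hcq _) (hCq _)) (abs_nonneg _) hCN0
  have hφi : Integrable (uncurry φ) (μ.prod π) :=
    Integrable.mono' (integrable_const _) hφm.aestronglyMeasurable
      (ae_of_all _ fun p => by rw [Real.norm_eq_abs]; exact hφb p.1 p.2)
  -- Step 2: average over `g` and swap the integrals
  have hstep2 : ∫ U, Nf U * Real.log (q U) ∂π = ∫ U, ∫ g, φ g U ∂μ ∂π := by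
    have hconst : ∫ g, (∫ U, Nf U * Real.log (q U) ∂π) ∂μ = ∫ U, Nf U * Real.log (q U) ∂π := by
      rw [integral_const, Measure.real, measure_univ, ENNReal.toReal_one, one_smul]
    rw [← hconst, integral_congr_ae (ae_of_all _ fun g => hstep1 g)]
    exact integral_integral_swap hφi
  -- Step 3: `∫_G q(U[ℓ₁ ↦ c_g(U_{ℓ₁})]) dg = q̄(U)`, and Jensen
  have hqvm : ∀ U : GaugeConfig d L G, Measurable fun v => q (update U ℓ₁ v) :=
    fun U => hqm.comp (measurable_update U)
  have havg : ∀ U : GaugeConfig d L G,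
      ∫ g, q (update U ℓ₁ (c g (U ℓ₁))) ∂μ = ∫ v, q (update U ℓ₁ v) ∂μ := by
    intro U
    have h := integral_map (hcmp (U ℓ₁)).measurable.aemeasurable (hqvm U).aestronglyMeasurable
      (μ := μ) (φ := fun g => c g (U ℓ₁))
    rw [(hcmp (U ℓ₁)).map_eq] at h
    exact h.symm
  have hgm : ∀ U : GaugeConfig d L G, Measurable fun g : G => q (update U ℓ₁ (c g (U ℓ₁))) :=
    fun U => hqum.comp (measurable_id.prodMk measurable_const)
  have hjensen : ∀ U : GaugeConfig d L G,
      ∫ g, Real.log (q (update U ℓ₁ (c g (U ℓ₁)))) ∂μ ≤ Real.log (∫ v, q (update U ℓ₁ v) ∂μ) := by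
    intro U
    rw [← havg U]
    have hconc : ConcaveOn ℝ (Icc c₀ Cq) Real.log :=
      strictConcaveOn_log_Ioi.concaveOn.subset (fun t ht => lt_of_lt_of_le hc₀ ht.1) (convex_Icc c₀ Cq)
    have hcont : ContinuousOn Real.log (Icc c₀ Cq) :=
      Real.continuousOn_log.mono fun t ht => ne_of_gt (lt_of_lt_of_le hc₀ ht.1)
    have hfi : Integrable (fun g : G => q (update U ℓ₁ (c g (U ℓ₁)))) μ :=
      Integrable.mono' (integrable_const Cq) (hgm U).aestronglyMeasurable
        (ae_of_all _ fun g => by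
          rw [Real.norm_eq_abs, abs_of_pos (hqpos _)]; exact hCq _)
    have hgi : Integrable (Real.log ∘ fun g : G => q (update U ℓ₁ (c g (U ℓ₁)))) μ :=
      Integrable.mono' (integrable_const B) (Real.measurable_log.comp (hgm U)).aestronglyMeasurable
        (ae_of_all _ fun g => by
          rw [Real.norm_eq_abs]; exact hlogb _ (hcq _) (hCq _))
    exact hconc.le_map_integral hcont isClosed_Icc (ae_of_all _ fun g => ⟨hcq _, hCq _⟩) hfi hgi
  -- Step 4: pointwise `∫_G φ g U dg ≤ Nf U · log q̄(U)`
  have hinner : ∀ U : GaugeConfig d L G,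
      ∫ g, φ g U ∂μ ≤ Nf U * Real.log (∫ v, q (update U ℓ₁ v) ∂μ) := by
    intro U
    simp only [hφ]
    rw [integral_const_mul]
    exact mul_le_mul_of_nonneg_left (hjensen U) (hN0 U)
  -- Step 5: integrate (`q̄ ∈ [c₀, Cq]` keeps the right side integrable)
  have hqbm : Measurable fun U : GaugeConfig d L G => ∫ v, q (update U ℓ₁ v) ∂μ := by
    have hm : Measurable fun p : GaugeConfig d L G × G => q (update p.1 ℓ₁ p.2) :=
      hqm.comp (measurable_pi_lambda _ fun e => by
        by_cases he : e = ℓ₁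
        · subst he; simp only [update_self]; exact measurable_snd
        · simp only [update_of_ne he]; exact (measurable_pi_apply e).comp measurable_fst)
    exact (hm.stronglyMeasurable.integral_prod_right' (ν := μ)).measurable
  have hqbI : ∀ U : GaugeConfig d L G,
      c₀ ≤ ∫ v, q (update U ℓ₁ v) ∂μ ∧ ∫ v, q (update U ℓ₁ v) ∂μ ≤ Cq := by
    intro U
    have hqi : Integrable (fun v => q (update U ℓ₁ v)) μ :=
      Integrable.mono' (integrable_const Cq) (hqvm U).aestronglyMeasurable
        (ae_of_all _ fun v => by rw [Real.norm_eq_abs, abs_of_pos (hqpos _)]; exact hCq _)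
    have h1 := integral_mono (integrable_const c₀) hqi (fun v => hcq (update U ℓ₁ v))
    have h2 := integral_mono hqi (integrable_const Cq) (fun v => hCq (update U ℓ₁ v))
    simp only [integral_const, Measure.real, measure_univ, ENNReal.toReal_one, one_smul] at h1 h2
    exact ⟨h1, h2⟩
  have hli : Integrable (fun U => Nf U * Real.log (∫ v, q (update U ℓ₁ v) ∂μ)) π :=
    Integrable.mono' (integrable_const (CN * B)) (hNm.mul (Real.measurable_log.comp hqbm)).aestronglyMeasurable
      (ae_of_all _ fun U => by
        rw [Real.norm_eq_abs, abs_mul]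
        exact mul_le_mul (hNabs U) (hlogb _ (hqbI U).1 (hqbI U).2) (abs_nonneg _) hCN0)
  have hri : Integrable (fun U => ∫ g, φ g U ∂μ) π := MeasureTheory.Integrable.integral_prod_right hφi
  rw [hstep2]
  exact integral_mono hri hli hinner

/-! ## §3 The two corners of a plaquette's closing link (through `x + e_k`, out of `x`) -/

omit [SecondCountableTopology G] in
/-- `A_s F` of a non-negative bounded measurable weight is measurable, non-negative and bounded. [ours] -/
theorem coordAvg_props_of_nonneg (s : Finset (Edge d L)) {F : GaugeConfig d L G → ℝ} (hFm : Measurable F)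
    (hF0 : ∀ U, 0 ≤ F U) (hFb : ∃ C, ∀ U, F U ≤ C) :
    Measurable (coordAvg (haarProbability G) s F) ∧ (∀ U, 0 ≤ coordAvg (haarProbability G) s F U) ∧
      ∃ C, ∀ U, coordAvg (haarProbability G) s F U ≤ C := by
  classical
  obtain ⟨C, hC⟩ := hFb
  exact ⟨measurable_coordAvg _ s hFm, fun U => (coordAvg_mem_Icc _ s hFm hF0 hC U).1, C,
    fun U => (coordAvg_mem_Icc _ s hFm hF0 hC U).2⟩

/-- **THROUGH a corner** (`ℓ₁` arrives at `y`, `ℓ₂` leaves, all other links at `y` integrated): for `q` blind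
to `ℓ₂`, `∫ A_s F·log q dπ ≤ ∫ A_s F·log q̄ dπ` with `q̄` the Haar average of `q` over `ℓ₁`. [ours] -/
theorem integral_mul_log_le_avg_of_cornerThrough (s : Finset (Edge d L))
    {F : GaugeConfig d L G → ℝ} (hF : IsGaugeInvariant F) (hFm : Measurable F) (hF0 : ∀ U, 0 ≤ F U)
    (hFb : ∃ C, ∀ U, F U ≤ C)
    {y : Site d L} {ℓ₁ ℓ₂ : Edge d L} (hne : ℓ₁ ≠ ℓ₂) (h₁ : ℓ₁.1.shift ℓ₁.2 = y) (h₁' : ℓ₁.1 ≠ y)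
    (h₂ : ℓ₂.1 = y) (h₂' : ℓ₂.1.shift ℓ₂.2 ≠ y)
    (hstar : ∀ e : Edge d L, e.1 = y ∨ e.1.shift e.2 = y → e ≠ ℓ₁ → e ≠ ℓ₂ → e ∈ s)
    {q : GaugeConfig d L G → ℝ} (hqm : Measurable q) (hqc : ∃ c, 0 < c ∧ ∀ U, c ≤ q U)
    (hqC : ∃ C, ∀ U, q U ≤ C) (hq₂ : ∀ U v, q (update U ℓ₂ v) = q U) :
    ∫ U, coordAvg (haarProbability G) s F U * Real.log (q U)
        ∂Measure.pi (fun _ : Edge d L => haarProbability G) ≤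
      ∫ U, coordAvg (haarProbability G) s F U * Real.log (∫ v, q (update U ℓ₁ v) ∂(haarProbability G))
        ∂Measure.pi (fun _ : Edge d L => haarProbability G) := by
  obtain ⟨T, hTmp, hT, hmove⟩ := cornerThrough_moves (G := G) hF hne h₁ h₁' h₂ h₂'
  obtain ⟨hNm, hN0, hNb⟩ := coordAvg_props_of_nonneg (G := G) s hFm hF0 hFb
  refine integral_mul_log_le_of_moves ℓ₁ hNm hN0 hNb hqm hqc hqC T hTmp (hmove s hstar)
    (fun g v => v * g⁻¹) (measurable_snd.mul measurable_fst.inv)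
    (fun v => (measurePreserving_mul_left _ v).comp (Measure.measurePreserving_inv (haarProbability G)))
    fun g U => ?_
  rw [hT, hq₂]

/-- **Both links LEAVING the corner**: for `q` blind to `ℓ₂`, `∫ A_s F·log q dπ ≤ ∫ A_s F·log q̄ dπ`. [ours] -/
theorem integral_mul_log_le_avg_of_cornerOut (s : Finset (Edge d L))
    {F : GaugeConfig d L G → ℝ} (hF : IsGaugeInvariant F) (hFm : Measurable F) (hF0 : ∀ U, 0 ≤ F U)
    (hFb : ∃ C, ∀ U, F U ≤ C)
    {y : Site d L} {ℓ₁ ℓ₂ : Edge d L} (hne : ℓ₁ ≠ ℓ₂) (h₁ : ℓ₁.1 = y) (h₁' : ℓ₁.1.shift ℓ₁.2 ≠ y)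
    (h₂ : ℓ₂.1 = y) (h₂' : ℓ₂.1.shift ℓ₂.2 ≠ y)
    (hstar : ∀ e : Edge d L, e.1 = y ∨ e.1.shift e.2 = y → e ≠ ℓ₁ → e ≠ ℓ₂ → e ∈ s)
    {q : GaugeConfig d L G → ℝ} (hqm : Measurable q) (hqc : ∃ c, 0 < c ∧ ∀ U, c ≤ q U)
    (hqC : ∃ C, ∀ U, q U ≤ C) (hq₂ : ∀ U v, q (update U ℓ₂ v) = q U) :
    ∫ U, coordAvg (haarProbability G) s F U * Real.log (q U)
        ∂Measure.pi (fun _ : Edge d L => haarProbability G) ≤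
      ∫ U, coordAvg (haarProbability G) s F U * Real.log (∫ v, q (update U ℓ₁ v) ∂(haarProbability G))
        ∂Measure.pi (fun _ : Edge d L => haarProbability G) := by
  obtain ⟨T, hTmp, hT, hmove⟩ := cornerOut_moves (G := G) hF hne h₁ h₁' h₂ h₂'
  obtain ⟨hNm, hN0, hNb⟩ := coordAvg_props_of_nonneg (G := G) s hFm hF0 hFb
  refine integral_mul_log_le_of_moves ℓ₁ hNm hN0 hNb hqm hqc hqC T hTmp (hmove s hstar)
    (fun g v => g * v) (measurable_fst.mul measurable_snd)
    (fun v => measurePreserving_mul_right (haarProbability G) v) fun g U => ?_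
  rw [hT, hq₂]

/-! ## §4 Normalised proposals: never better than the flat proposal -/

/-- **THROUGH a corner, normalised**: if `q` is moreover a probability density in the `ℓ₁` coordinate then its
`A_s F`-weighted expected log-likelihood is at most that of the flat Haar proposal: `∫ A_s F·log q dπ ≤ 0`.
[ours] -/
theorem integral_mul_log_nonpos_of_cornerThrough (s : Finset (Edge d L))
    {F : GaugeConfig d L G → ℝ} (hF : IsGaugeInvariant F) (hFm : Measurable F) (hF0 : ∀ U, 0 ≤ F U)
    (hFb : ∃ C, ∀ U, F U ≤ C)
    {y : Site d L} {ℓ₁ ℓ₂ : Edge d L} (hne : ℓ₁ ≠ ℓ₂) (h₁ : ℓ₁.1.shift ℓ₁.2 = y) (h₁' : ℓ₁.1 ≠ y)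
    (h₂ : ℓ₂.1 = y) (h₂' : ℓ₂.1.shift ℓ₂.2 ≠ y)
    (hstar : ∀ e : Edge d L, e.1 = y ∨ e.1.shift e.2 = y → e ≠ ℓ₁ → e ≠ ℓ₂ → e ∈ s)
    {q : GaugeConfig d L G → ℝ} (hqm : Measurable q) (hqc : ∃ c, 0 < c ∧ ∀ U, c ≤ q U)
    (hqC : ∃ C, ∀ U, q U ≤ C) (hq₂ : ∀ U v, q (update U ℓ₂ v) = q U)
    (hq₁ : ∀ U, ∫ v, q (update U ℓ₁ v) ∂(haarProbability G) = 1) :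
    ∫ U, coordAvg (haarProbability G) s F U * Real.log (q U)
        ∂Measure.pi (fun _ : Edge d L => haarProbability G) ≤ 0 := by
  have h := integral_mul_log_le_avg_of_cornerThrough s hF hFm hF0 hFb hne h₁ h₁' h₂ h₂' hstar hqm hqc hqC hq₂
  simpa only [hq₁, Real.log_one, mul_zero, integral_zero] using h

/-- **OUT-corner, normalised**: `∫ A_s F·log q dπ ≤ 0`. [ours] -/
theorem integral_mul_log_nonpos_of_cornerOut (s : Finset (Edge d L))
    {F : GaugeConfig d L G → ℝ} (hF : IsGaugeInvariant F) (hFm : Measurable F) (hF0 : ∀ U, 0 ≤ F U)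
    (hFb : ∃ C, ∀ U, F U ≤ C)
    {y : Site d L} {ℓ₁ ℓ₂ : Edge d L} (hne : ℓ₁ ≠ ℓ₂) (h₁ : ℓ₁.1 = y) (h₁' : ℓ₁.1.shift ℓ₁.2 ≠ y)
    (h₂ : ℓ₂.1 = y) (h₂' : ℓ₂.1.shift ℓ₂.2 ≠ y)
    (hstar : ∀ e : Edge d L, e.1 = y ∨ e.1.shift e.2 = y → e ≠ ℓ₁ → e ≠ ℓ₂ → e ∈ s)
    {q : GaugeConfig d L G → ℝ} (hqm : Measurable q) (hqc : ∃ c, 0 < c ∧ ∀ U, c ≤ q U)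
    (hqC : ∃ C, ∀ U, q U ≤ C) (hq₂ : ∀ U v, q (update U ℓ₂ v) = q U)
    (hq₁ : ∀ U, ∫ v, q (update U ℓ₁ v) ∂(haarProbability G) = 1) :
    ∫ U, coordAvg (haarProbability G) s F U * Real.log (q U)
        ∂Measure.pi (fun _ : Edge d L => haarProbability G) ≤ 0 := by
  have h := integral_mul_log_le_avg_of_cornerOut s hF hFm hF0 hFb hne h₁ h₁' h₂ h₂' hstar hqm hqc hqC hq₂
  simpa only [hq₁, Real.log_one, mul_zero, integral_zero] using h

/-- **Against the weight itself** (through-corner; `q` reads no integrated link): the expected log-likelihood of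
`q` under `F·π` is at most that of the flat proposal, `∫ F·log q dπ ≤ 0` (tower property
`∫ F·Φ = ∫ A_s F·Φ` for `Φ = log q` blind to `s`). [ours] -/
theorem integral_weight_mul_log_nonpos_of_cornerThrough (s : Finset (Edge d L))
    {F : GaugeConfig d L G → ℝ} (hF : IsGaugeInvariant F) (hFm : Measurable F) (hF0 : ∀ U, 0 ≤ F U)
    (hFb : ∃ C, ∀ U, F U ≤ C)
    {y : Site d L} {ℓ₁ ℓ₂ : Edge d L} (hne : ℓ₁ ≠ ℓ₂) (h₁ : ℓ₁.1.shift ℓ₁.2 = y) (h₁' : ℓ₁.1 ≠ y)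
    (h₂ : ℓ₂.1 = y) (h₂' : ℓ₂.1.shift ℓ₂.2 ≠ y)
    (hstar : ∀ e : Edge d L, e.1 = y ∨ e.1.shift e.2 = y → e ≠ ℓ₁ → e ≠ ℓ₂ → e ∈ s)
    {q : GaugeConfig d L G → ℝ} (hqm : Measurable q) (hqc : ∃ c, 0 < c ∧ ∀ U, c ≤ q U)
    (hqC : ∃ C, ∀ U, q U ≤ C) (hq₂ : ∀ U v, q (update U ℓ₂ v) = q U)
    (hq₁ : ∀ U, ∫ v, q (update U ℓ₁ v) ∂(haarProbability G) = 1)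
    (hqs : ∀ U V, q (s.piecewise V U) = q U) :
    ∫ U, F U * Real.log (q U) ∂Measure.pi (fun _ : Edge d L => haarProbability G) ≤ 0 := by
  obtain ⟨c₀, hc₀, hcq⟩ := hqc
  obtain ⟨Cq, hCq⟩ := hqC
  obtain ⟨CF, hCF⟩ := hFb
  have hlogb : ∀ U, |Real.log (q U)| ≤ |Real.log c₀| + |Real.log Cq| := by
    intro U
    have h0 : 0 < q U := lt_of_lt_of_le hc₀ (hcq U)
    have hlo : Real.log c₀ ≤ Real.log (q U) := Real.log_le_log hc₀ (hcq U)
    have hhi : Real.log (q U) ≤ Real.log Cq := Real.log_le_log h0 (hCq U)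
    rw [abs_le]
    constructor
    · linarith [neg_abs_le (Real.log c₀), abs_nonneg (Real.log Cq)]
    · linarith [le_abs_self (Real.log Cq), abs_nonneg (Real.log c₀)]
  have htower := integral_coordAvg_mul_eq (haarProbability G) s hFm
    ⟨CF, fun U => by rw [abs_of_nonneg (hF0 U)]; exact hCF U⟩ (Φ := fun U => Real.log (q U))
    (Real.measurable_log.comp hqm) ⟨_, hlogb⟩ (fun U V => by show Real.log _ = Real.log _; rw [hqs])
  rw [htower]
  exact integral_mul_log_nonpos_of_cornerThrough s hF hFm hF0 ⟨CF, hCF⟩ hne h₁ h₁' h₂ h₂' hstar hqm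
    ⟨c₀, hc₀, hcq⟩ ⟨Cq, hCq⟩ hq₂ hq₁

end Summit.Ventures.LatticeQCDFlow.Theory2.Autoregressive

end
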